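import Summits.CriticalPhenomena.Ising3D.ExclusionSentences

/-!
# Exclusion sentences for the other rational-CFT tables (family `KACX`; cell `pub-ising3x`, recog-1)

HONEST FRAMING: lottery ticket; floor = tightest certified 3D Ising CFT bounds; no exact-solution
claim without a proof.

Family `KACX` of the frozen list FAMILIES-v1 (`HOME/frozen/FAMILIES-v1.json` b39f709f…, SCOPE.md §3.1;
`HOME/code/recog/families.py kacx_tables` is the definition of record, transcribed here loop for loop):
the values `h` and `2h` (`h > 0`) of four further rational-CFT weight tables —
* `N1`: `N = 1` superconformal minimal models `SM(p,p′)`, `2 ≤ p < p′ ≤ 24`, `p′ ≡ p (mod 2)`,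
  coprime if `p` odd, `gcd = 2` with `(p′−p)/2` odd if `p` even; `1 ≤ r ≤ p−1`, `1 ≤ s ≤ p′−1`;
  `h_{r,s} = ((p′r − ps)² − (p′−p)²)/(8pp′) + (1 − (−1)^{r−s})/32` (Friedan–Qiu–Shenker 1985);
* `W3`: `W₃` minimal models `W3(p,p′)`, `3 ≤ p < p′ ≤ 16` coprime; `n₁,n₂ ≥ 1`, `n₁+n₂ ≤ p−1`,
  `m₁,m₂ ≥ 1`, `m₁+m₂ ≤ p′−1`; `h = (u² + uv + v² − 3(p′−p)²)/(3pp′)`, `u = p′n₁ − pm₁`, `v = p′n₂ − pm₂`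
  (Fateev–Zamolodchikov 1987);
* `SU2`: `SU(2)_k` WZW, `1 ≤ k ≤ 38` (size `k+2 ≤ 40`), `h_j = j(j+1)/(k+2)`, `2j = 1..k`
  (Knizhnik–Zamolodchikov 1984);
* `ZK`: `ℤ_k` parafermions, `2 ≤ k ≤ 38`, `0 ≤ l ≤ k`, `−2k+l+1 ≤ m ≤ 2k−l`, `l ≡ m (mod 2)`,
  `h = l(l+2)/(4(k+2)) − m²/(4k) + [l < |m|]·(|m| − l)/2` (Fateev–Zamolodchikov 1985);
(all as in Di Francesco–Mathieu–Sénéchal 1997, ch. 18, which the frozen spec cites). As in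
`ExclusionSentences.lean`, each table gets an integer-only `Bool` checker and a soundness theorem
("checker `= true` ⇒ every member in `[a, b]` is in the exception list"), the union `kacxFamily` gets
`kacx_sound` / `ne_kacx_of_checks`, and `sigma_not_kacx_of_isingEnclosure` / `eps_not_kacx_of_isingEnclosure` are the
sentences under `IsingEnclosure W R`. Kernel cost (`decide +kernel`, measured on the farm; the
loops always run over the whole table, so the cost does not depend on the interval): SU2 < 1 s,
N1 ≈ 8 s, ZK ≈ 20 s, W3 ≈ 5–20 s PER `p′` and ≈ 65 s in total — more than one declaration's default
heartbeat budget, so the W3 checker is exposed per `p′` (`w3ExcludedPP`) and `w3_sound` / `kacx_sound`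
take `∀ p′ ∈ [4, 16]` of them, to be assembled from thirteen one-line theorems (one `decide +kernel`
each; a single declaration running all thirteen exceeds `maxHeartbeats 200000` — measured).
Validation against the definition of record (two implementations): on the window `[0.124, 0.126]` the
member lists of all four checkers (SU2 `{1/8}`, N1 `{33/266, 20/161, 181/1456, 1/8, 419/3344, 75/598}`,
ZK `{135/1088, 181/1456, 28/225, 1/8, 18/143}`, W3 per `p′`: `17/135 (10)`, `37/297 (11)`, `18/143 (13)`,
`34/273 (14)`, `62/495 (15)`, `1/8 (16)`, none otherwise) agree with an independent Python
re-derivation of `families.py kacx_tables` (36 162 distinct values reproduced), each list accepted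
(`= true`) and each list with one member removed rejected (`= false`) by the kernel (seat folder
`work/KacxCombinedTest*.lean`, farm rc 0). No 3D digit is used anywhere; examples live in the control file.
-/

namespace Summit.CriticalPhenomena.Ising3D

open Literature.MathematicalPhysics.QuantumFieldTheory.ConformalBootstrap3D

/-! ### Shared integer helpers: one value `X/D`, and the pair `h, 2h` with `h = X/D > 0` -/

/-- Exception list as `(num, den)` pairs. -/
def exZ (ex : List ℚ) : List (ℤ × ℕ) := ex.map fun e => (e.num, e.den)

/-- `X/D` (with `D > 0`) lies outside `[an/ad, bn/bd]`, or equals a listed exception (cross-multiplied). -/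
def ratOutOrListed (X : ℤ) (D : ℕ) (an : ℤ) (ad : ℕ) (bn : ℤ) (bd : ℕ) (ex : List (ℤ × ℕ)) : Bool :=
  !(decide (an * (D : ℤ) ≤ X * (ad : ℤ)) && decide (X * (bd : ℤ) ≤ bn * (D : ℤ))) ||
    ex.any fun e => decide (X * (e.2 : ℤ) = e.1 * (D : ℤ))

/-- Soundness of `ratOutOrListed`. -/
theorem ratOutOrListed_sound {X : ℤ} {D : ℕ} (hD : 0 < D) {a b : ℚ} {ex : List ℚ}
    (h : ratOutOrListed X D a.num a.den b.num b.den (exZ ex) = true)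
    (ha : a ≤ (X : ℚ) / (D : ℚ)) (hb : (X : ℚ) / (D : ℚ) ≤ b) : (X : ℚ) / (D : ℚ) ∈ ex := by
  unfold ratOutOrListed at h
  have ha' := (le_intDiv_iff a X hD).mp ha
  have hb' := (intDiv_le_iff b X hD).mp hb
  rw [Bool.or_eq_true] at h
  rcases h with h | h
  · simp [ha', hb'] at h
  · obtain ⟨e, he, hdec⟩ := List.any_eq_true.mp h
    rw [decide_eq_true_eq] at hdec
    unfold exZ at he
    rw [List.mem_map] at he
    obtain ⟨q, hq, rfl⟩ := he
    exact (intDiv_eq_of_cross q X hD hdec) ▸ hq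

/-- The two members `h = X/D` and `2h` of a table entry, present only when `h > 0`. -/
def hPairCheck (X : ℤ) (D : ℕ) (an : ℤ) (ad : ℕ) (bn : ℤ) (bd : ℕ) (ex : List (ℤ × ℕ)) : Bool :=
  decide (X ≤ 0) || (ratOutOrListed X D an ad bn bd ex && ratOutOrListed (2 * X) D an ad bn bd ex)

/-- Soundness of `hPairCheck`: if `h = X/D > 0` and `v ∈ {h, 2h}` lies in `[a, b]` then `v ∈ ex`. -/
theorem hPairCheck_sound {X : ℤ} {D : ℕ} (hD : 0 < D) {a b : ℚ} {ex : List ℚ}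
    (h : hPairCheck X D a.num a.den b.num b.den (exZ ex) = true) {v : ℚ}
    (hpos : 0 < (X : ℚ) / (D : ℚ)) (hv : v = (X : ℚ) / (D : ℚ) ∨ v = 2 * ((X : ℚ) / (D : ℚ)))
    (ha : a ≤ v) (hb : v ≤ b) : v ∈ ex := by
  unfold hPairCheck at h
  have hD' : (0 : ℚ) < D := by exact_mod_cast hD
  have hX : 0 < X := by
    have h1 := mul_pos hpos hD'
    rw [div_mul_cancel₀ (X : ℚ) hD'.ne'] at h1
    exact_mod_cast h1
  rw [Bool.or_eq_true, decide_eq_true_eq, Bool.and_eq_true] at h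
  rcases h with h | ⟨h1, h2⟩
  · omega
  · rcases hv with rfl | rfl
    · exact ratOutOrListed_sound hD h1 ha hb
    · have e : (2 : ℚ) * ((X : ℚ) / D) = ((2 * X : ℤ) : ℚ) / (D : ℚ) := by push_cast; ring
      rw [e] at ha hb ⊢
      exact ratOutOrListed_sound hD h2 ha hb

/-! ### `SU2`: `SU(2)_k` WZW weights `h_j = j(j+1)/(k+2)`, `2j = tj ∈ [1, k]` -/

/-- `h_j (SU(2)_k) = tj(tj+2)/(4(k+2))` with `tj = 2j`. -/
def su2Weight (k tj : ℕ) : ℚ := (((tj * (tj + 2) : ℕ) : ℤ) : ℚ) / ((4 * (k + 2) : ℕ) : ℚ)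

/-- The `SU2` sub-table with sizes `k + 2 ≤ S` (`families.py`: `k = 1 .. S−2`, `tj = 1 .. k`; members `h, 2h`). -/
def su2Family (S : ℕ) : Set ℚ :=
  {v | ∃ k tj : ℕ, 1 ≤ k ∧ k + 2 ≤ S ∧ 1 ≤ tj ∧ tj ≤ k ∧ 0 < su2Weight k tj ∧
    (v = su2Weight k tj ∨ v = 2 * su2Weight k tj)}

/-- Integer checker for `SU2`. -/
def su2Core (S : ℕ) (an : ℤ) (ad : ℕ) (bn : ℤ) (bd : ℕ) (ex : List (ℤ × ℕ)) : Bool :=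
  (List.range' 1 (S - 2)).all fun k =>
    (List.range' 1 k).all fun tj => hPairCheck ((tj * (tj + 2) : ℕ) : ℤ) (4 * (k + 2)) an ad bn bd ex

/-- Soundness of `su2Core`. -/
theorem su2Core_sound {S : ℕ} {a b : ℚ} {ex : List ℚ}
    (h : su2Core S a.num a.den b.num b.den (exZ ex) = true) {v : ℚ} (hv : v ∈ su2Family S)
    (ha : a ≤ v) (hb : v ≤ b) : v ∈ ex := by
  simp only [su2Family, Set.mem_setOf_eq] at hv
  obtain ⟨k, tj, hk, hkS, htj, htjk, hpos, hv⟩ := hv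
  unfold su2Core at h
  have h1 := List.all_eq_true.mp h k (List.mem_range'_1.mpr ⟨hk, by omega⟩)
  have h2 := List.all_eq_true.mp h1 tj (List.mem_range'_1.mpr ⟨htj, by omega⟩)
  exact hPairCheck_sound (by positivity) h2 hpos hv ha hb

/-! ### `ZK`: `ℤ_k` parafermion weights -/

/-- Numerator of `h(l, m)` over `4k(k+2)`: `l(l+2)k − m²(k+2) + [l < |m|]·2k(k+2)(|m| − l)`. -/
def zkNum (k l : ℕ) (m : ℤ) : ℤ :=
  ((l * (l + 2) * k : ℕ) : ℤ) - m ^ 2 * ((k + 2 : ℕ) : ℤ) +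
    (if (l : ℤ) < (m.natAbs : ℤ) then 2 * (k : ℤ) * ((k + 2 : ℕ) : ℤ) * ((m.natAbs : ℤ) - l) else 0)

/-- `h(l,m)` of the `ℤ_k` parafermions as one fraction over `4k(k+2)`. -/
def zkWeight (k l : ℕ) (m : ℤ) : ℚ := ((zkNum k l m : ℤ) : ℚ) / ((4 * k * (k + 2) : ℕ) : ℚ)

/-- `zkWeight` is the printed formula `l(l+2)/(4(k+2)) − m²/(4k) + [l < |m|] (|m| − l)/2`. -/
theorem zkWeight_eq {k : ℕ} (hk : 0 < k) (l : ℕ) (m : ℤ) :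
    zkWeight k l m = (l : ℚ) * (l + 2) / (4 * (k + 2)) - (m : ℚ) ^ 2 / (4 * k) +
      (if (l : ℤ) < |m| then ((|m| : ℤ) - l : ℚ) / 2 else 0) := by
  unfold zkWeight zkNum
  have hk0 : (k : ℚ) ≠ 0 := by positivity
  have hk2 : (k : ℚ) + 2 ≠ 0 := by positivity
  rw [Int.natCast_natAbs]
  split_ifs <;> push_cast <;> field_simp <;> ring

/-- The `ZK` sub-table with sizes `k + 2 ≤ S` (`families.py`: `k = 2 .. S−2`, `l = 0 .. k`,
`m = −2k+l+1 .. 2k−l` with `l − m` even; members `h, 2h` for `h > 0`). -/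
def zkFamily (S : ℕ) : Set ℚ :=
  {v | ∃ (k l : ℕ) (m : ℤ), 2 ≤ k ∧ k + 2 ≤ S ∧ l ≤ k ∧ -(2 * k : ℤ) + l + 1 ≤ m ∧ m ≤ 2 * k - l ∧
    Even ((l : ℤ) - m) ∧ 0 < zkWeight k l m ∧ (v = zkWeight k l m ∨ v = 2 * zkWeight k l m)}

/-- Integer checker for `ZK`. -/
def zkCore (S : ℕ) (an : ℤ) (ad : ℕ) (bn : ℤ) (bd : ℕ) (ex : List (ℤ × ℕ)) : Bool :=
  (List.range' 2 (S - 3)).all fun k =>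
    (List.range (k + 1)).all fun l =>
      allIntIcc (-(2 * k : ℤ) + l + 1) (2 * k - l) fun m =>
        !decide (Even ((l : ℤ) - m)) || hPairCheck (zkNum k l m) (4 * k * (k + 2)) an ad bn bd ex

/-- Soundness of `zkCore`. -/
theorem zkCore_sound {S : ℕ} {a b : ℚ} {ex : List ℚ}
    (h : zkCore S a.num a.den b.num b.den (exZ ex) = true) {v : ℚ} (hv : v ∈ zkFamily S)
    (ha : a ≤ v) (hb : v ≤ b) : v ∈ ex := by
  simp only [zkFamily, Set.mem_setOf_eq] at hv
  obtain ⟨k, l, m, hk, hkS, hl, hm1, hm2, hpar, hpos, hv⟩ := hv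
  unfold zkCore at h
  have h1 := List.all_eq_true.mp h k (List.mem_range'_1.mpr ⟨hk, by omega⟩)
  have h2 := List.all_eq_true.mp h1 l (List.mem_range.mpr (by omega))
  have h3 := allIntIcc_sound h2 hm1 hm2
  rw [Bool.or_eq_true] at h3
  rcases h3 with h3 | h3
  · simp [hpar] at h3
  · exact hPairCheck_sound (by positivity) h3 hpos hv ha hb

/-! ### `N1`: `N = 1` superconformal minimal models `SM(p,p′)` -/

/-- Numerator of `h^{N=1}_{r,s}(p,p′)` over `16 p p′`: `2((p′r − ps)² − (p′−p)²) + [r − s odd]·p p′`. -/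
def n1Num (p pp r s : ℕ) : ℤ :=
  2 * kacNum p pp r s + (if Even ((r : ℤ) - s) then 0 else ((p * pp : ℕ) : ℤ))

/-- `h^{N=1}_{r,s}(p,p′)` as one fraction over `16 p p′`. -/
def n1Weight (p pp r s : ℕ) : ℚ := ((n1Num p pp r s : ℤ) : ℚ) / ((16 * p * pp : ℕ) : ℚ)

/-- `n1Weight` is the printed formula `((p′r − ps)² − (p′−p)²)/(8pp′) + (1 − (−1)^{r−s})/32`
(the last term is `0` for `r − s` even, `1/16` for `r − s` odd). -/
theorem n1Weight_eq {p pp : ℕ} (hp : 0 < p) (hpp : 0 < pp) (r s : ℕ) :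
    n1Weight p pp r s = (((pp : ℚ) * r - p * s) ^ 2 - ((pp : ℚ) - p) ^ 2) / (8 * p * pp) +
      (if Even ((r : ℤ) - s) then 0 else 1 / 16) := by
  unfold n1Weight n1Num kacNum
  have hp0 : (p : ℚ) ≠ 0 := by positivity
  have hpp0 : (pp : ℚ) ≠ 0 := by positivity
  split_ifs <;> push_cast <;> field_simp <;> ring

/-- Admissible `(p, p′)` for `SM(p,p′)` exactly as `families.py`: `p′ − p` even; `p` odd ⇒ coprime;
`p` even ⇒ `gcd = 2` and `(p′−p)/2` odd. -/
def n1Admissible (p pp : ℕ) : Bool :=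
  (pp - p) % 2 == 0 &&
    (if p % 2 == 1 then Nat.gcd p pp == 1 else (Nat.gcd p pp == 2 && ((pp - p) / 2) % 2 == 1))

/-- The `N1` sub-table with sizes `p′ ≤ S` (`families.py`: `p′ = 3..S`, `p = 2..p′−1` admissible,
`r = 1..p−1`, `s = 1..p′−1`; members `h, 2h` for `h > 0`). -/
def n1Family (S : ℕ) : Set ℚ :=
  {v | ∃ p pp r s : ℕ, 2 ≤ p ∧ p < pp ∧ pp ≤ S ∧ n1Admissible p pp = true ∧ 1 ≤ r ∧ r < p ∧ 1 ≤ s ∧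
    s < pp ∧ 0 < n1Weight p pp r s ∧ (v = n1Weight p pp r s ∨ v = 2 * n1Weight p pp r s)}

/-- Integer checker for `N1`. -/
def n1Core (S : ℕ) (an : ℤ) (ad : ℕ) (bn : ℤ) (bd : ℕ) (ex : List (ℤ × ℕ)) : Bool :=
  (List.range' 3 (S - 2)).all fun pp =>
    (List.range' 2 (pp - 2)).all fun p =>
      !n1Admissible p pp ||
        (List.range' 1 (p - 1)).all fun r =>
          (List.range' 1 (pp - 1)).all fun s => hPairCheck (n1Num p pp r s) (16 * p * pp) an ad bn bd ex

/-- Soundness of `n1Core`. -/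
theorem n1Core_sound {S : ℕ} {a b : ℚ} {ex : List ℚ}
    (h : n1Core S a.num a.den b.num b.den (exZ ex) = true) {v : ℚ} (hv : v ∈ n1Family S)
    (ha : a ≤ v) (hb : v ≤ b) : v ∈ ex := by
  simp only [n1Family, Set.mem_setOf_eq] at hv
  obtain ⟨p, pp, r, s, hp, hppp, hS, hadm, hr1, hr, hs1, hs, hpos, hv⟩ := hv
  unfold n1Core at h
  have h1 := List.all_eq_true.mp h pp (List.mem_range'_1.mpr ⟨by omega, by omega⟩)
  have h2 := List.all_eq_true.mp h1 p (List.mem_range'_1.mpr ⟨hp, by omega⟩)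
  rw [Bool.or_eq_true] at h2
  rcases h2 with h2 | h2
  · simp [hadm] at h2
  · have h3 := List.all_eq_true.mp h2 r (List.mem_range'_1.mpr ⟨hr1, by omega⟩)
    have h4 := List.all_eq_true.mp h3 s (List.mem_range'_1.mpr ⟨hs1, by omega⟩)
    have hD : 0 < 16 * p * pp := Nat.mul_pos (Nat.mul_pos (by norm_num) (by omega)) (by omega)
    exact hPairCheck_sound hD h4 hpos hv ha hb

/-! ### `W3`: `W₃` minimal models `W3(p,p′)` -/

/-- Numerator of `h` over `3 p p′`: `u² + uv + v² − 3(p′−p)²`, `u = p′n₁ − pm₁`, `v = p′n₂ − pm₂`. -/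
def w3Num (p pp n₁ n₂ m₁ m₂ : ℕ) : ℤ :=
  (((pp * n₁ : ℕ) : ℤ) - ((p * m₁ : ℕ) : ℤ)) ^ 2 +
    (((pp * n₁ : ℕ) : ℤ) - ((p * m₁ : ℕ) : ℤ)) * (((pp * n₂ : ℕ) : ℤ) - ((p * m₂ : ℕ) : ℤ)) +
    (((pp * n₂ : ℕ) : ℤ) - ((p * m₂ : ℕ) : ℤ)) ^ 2 - 3 * ((pp : ℤ) - (p : ℤ)) ^ 2

/-- `h_{n₁n₂;m₁m₂}(W3(p,p′))` as one fraction over `3 p p′`. -/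
def w3Weight (p pp n₁ n₂ m₁ m₂ : ℕ) : ℚ := ((w3Num p pp n₁ n₂ m₁ m₂ : ℤ) : ℚ) / ((3 * p * pp : ℕ) : ℚ)

/-- The `W3` sub-table with sizes `p′ ≤ S` (`families.py`: `p′ = 4..S`, `p = 3..p′−1` coprime,
`n₁, n₂ ≥ 1`, `n₁ + n₂ ≤ p − 1`, `m₁, m₂ ≥ 1`, `m₁ + m₂ ≤ p′ − 1`; members `h, 2h` for `h > 0`). -/
def w3Family (S : ℕ) : Set ℚ :=
  {v | ∃ p pp n₁ n₂ m₁ m₂ : ℕ, 3 ≤ p ∧ p < pp ∧ pp ≤ S ∧ Nat.Coprime p pp ∧ 1 ≤ n₁ ∧ 1 ≤ n₂ ∧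
    n₁ + n₂ ≤ p - 1 ∧ 1 ≤ m₁ ∧ 1 ≤ m₂ ∧ m₁ + m₂ ≤ pp - 1 ∧ 0 < w3Weight p pp n₁ n₂ m₁ m₂ ∧
    (v = w3Weight p pp n₁ n₂ m₁ m₂ ∨ v = 2 * w3Weight p pp n₁ n₂ m₁ m₂)}

/-- Integer checker for the `W3` entries with a FIXED `p′` (one `decide +kernel` per `p′`). -/
def w3CorePP (pp : ℕ) (an : ℤ) (ad : ℕ) (bn : ℤ) (bd : ℕ) (ex : List (ℤ × ℕ)) : Bool :=
  (List.range' 3 (pp - 3)).all fun p =>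
    !decide (Nat.Coprime p pp) ||
      (List.range' 1 (p - 2)).all fun n₁ =>
        (List.range' 1 (p - 1 - n₁)).all fun n₂ =>
          (List.range' 1 (pp - 2)).all fun m₁ =>
            (List.range' 1 (pp - 1 - m₁)).all fun m₂ =>
              hPairCheck (w3Num p pp n₁ n₂ m₁ m₂) (3 * p * pp) an ad bn bd ex

/-- `W3` checker for a fixed `p′`, rational interface. -/
def w3ExcludedPP (pp : ℕ) (a b : ℚ) (ex : List ℚ) : Bool :=
  w3CorePP pp a.num a.den b.num b.den (exZ ex)

/-- Soundness of the `W3` checkers: if `w3ExcludedPP p′ a b ex = true` for every `p′ ∈ [4, S]` then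
every member of `w3Family S` in `[a, b]` is in `ex`. -/
theorem w3_sound {S : ℕ} {a b : ℚ} {ex : List ℚ}
    (h : ∀ pp : ℕ, 4 ≤ pp → pp ≤ S → w3ExcludedPP pp a b ex = true) {v : ℚ} (hv : v ∈ w3Family S)
    (ha : a ≤ v) (hb : v ≤ b) : v ∈ ex := by
  simp only [w3Family, Set.mem_setOf_eq] at hv
  obtain ⟨p, pp, n₁, n₂, m₁, m₂, hp, hppp, hS, hcop, hn1, hn2, hn, hm1, hm2, hm, hpos, hv⟩ := hv
  have h0 := h pp (by omega) hS
  unfold w3ExcludedPP w3CorePP at h0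
  have h1 := List.all_eq_true.mp h0 p (List.mem_range'_1.mpr ⟨hp, by omega⟩)
  rw [Bool.or_eq_true] at h1
  rcases h1 with h1 | h1
  · simp [hcop] at h1
  · have h2 := List.all_eq_true.mp h1 n₁ (List.mem_range'_1.mpr ⟨hn1, by omega⟩)
    have h3 := List.all_eq_true.mp h2 n₂ (List.mem_range'_1.mpr ⟨hn2, by omega⟩)
    have h4 := List.all_eq_true.mp h3 m₁ (List.mem_range'_1.mpr ⟨hm1, by omega⟩)
    have h5 := List.all_eq_true.mp h4 m₂ (List.mem_range'_1.mpr ⟨hm2, by omega⟩)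
    have hD : 0 < 3 * p * pp := Nat.mul_pos (Nat.mul_pos (by norm_num) (by omega)) (by omega)
    exact hPairCheck_sound hD h5 hpos hv ha hb

/-! ### The frozen family `KACX` = union of the four tables at the frozen sizes -/

/-- Rational interfaces of the three single-shot checkers. -/
def su2Excluded (S : ℕ) (a b : ℚ) (ex : List ℚ) : Bool := su2Core S a.num a.den b.num b.den (exZ ex)

/-- See `su2Excluded`. -/
def zkExcluded (S : ℕ) (a b : ℚ) (ex : List ℚ) : Bool := zkCore S a.num a.den b.num b.den (exZ ex)

/-- See `su2Excluded`. -/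
def n1Excluded (S : ℕ) (a b : ℚ) (ex : List ℚ) : Bool := n1Core S a.num a.den b.num b.den (exZ ex)

/-- `kacxFamily` = FAMILIES-v1 `KACX` (kind `Delta`): `N1` with `p′ ≤ 24`, `W3` with `p′ ≤ 16`,
`SU2` and `ZK` with size `k + 2 ≤ 40` (36 162 distinct values in the cell's table). -/
def kacxFamily : Set ℚ := n1Family 24 ∪ w3Family 16 ∪ su2Family 40 ∪ zkFamily 40

/-- **Soundness of the KACX sentence.** If the `N1`, `SU2`, `ZK` checkers and the thirteen `W3`
checkers (`p′ = 4..16`) all return `true` on `[a, b]` with exception list `ex`, then every member of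
`kacxFamily` in `[a, b]` belongs to `ex`. -/
theorem kacx_sound {a b : ℚ} {ex : List ℚ} (hN1 : n1Excluded 24 a b ex = true)
    (hW3 : ∀ pp : ℕ, 4 ≤ pp → pp ≤ 16 → w3ExcludedPP pp a b ex = true)
    (hSU2 : su2Excluded 40 a b ex = true) (hZK : zkExcluded 40 a b ex = true) {v : ℚ}
    (hv : v ∈ kacxFamily) (ha : a ≤ v) (hb : v ≤ b) : v ∈ ex := by
  unfold kacxFamily at hv
  rcases hv with ((hv | hv) | hv) | hv
  · exact n1Core_sound hN1 hv ha hb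
  · exact w3_sound hW3 hv ha hb
  · exact su2Core_sound hSU2 hv ha hb
  · exact zkCore_sound hZK hv ha hb

/-- Real-number form of the KACX sentence. -/
theorem ne_kacx_of_checks {a b : ℚ} {ex : List ℚ} (hN1 : n1Excluded 24 a b ex = true)
    (hW3 : ∀ pp : ℕ, 4 ≤ pp → pp ≤ 16 → w3ExcludedPP pp a b ex = true)
    (hSU2 : su2Excluded 40 a b ex = true) (hZK : zkExcluded 40 a b ex = true) {x : ℝ}
    (hx : (a : ℝ) ≤ x ∧ x ≤ b) (v : ℚ) (hv : v ∈ kacxFamily) (hvex : v ∉ ex) : x ≠ (v : ℝ) := by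
  rintro rfl
  exact hvex (kacx_sound hN1 hW3 hSU2 hZK hv (by exact_mod_cast hx.1) (by exact_mod_cast hx.2))

/-- **KACX sentence for `Δ_σ`** under `IsingEnclosure W R` (cf. `sigma_not_kac_of_isingEnclosure`). -/
theorem sigma_not_kacx_of_isingEnclosure {W R : Set (ℝ × ℝ)} (h : IsingEnclosure W R) {a b : ℚ}
    (hR : ∀ q ∈ R, (a : ℝ) ≤ q.1 ∧ q.1 ≤ b) {ex : List ℚ} (hN1 : n1Excluded 24 a b ex = true)
    (hW3 : ∀ pp : ℕ, 4 ≤ pp → pp ≤ 16 → w3ExcludedPP pp a b ex = true)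
    (hSU2 : su2Excluded 40 a b ex = true) (hZK : zkExcluded 40 a b ex = true)
    (D : SigmaEpsilonData) (hD : D.SatisfiesBootstrapAxioms) (hW : (D.Δσ, D.Δε) ∈ W) (v : ℚ)
    (hv : v ∈ kacxFamily) (hvex : v ∉ ex) : D.Δσ ≠ (v : ℝ) :=
  ne_kacx_of_checks hN1 hW3 hSU2 hZK (hR _ (h D hD hW)) v hv hvex

/-- **KACX sentence for `Δ_ε`.** -/
theorem eps_not_kacx_of_isingEnclosure {W R : Set (ℝ × ℝ)} (h : IsingEnclosure W R) {a b : ℚ}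
    (hR : ∀ q ∈ R, (a : ℝ) ≤ q.2 ∧ q.2 ≤ b) {ex : List ℚ} (hN1 : n1Excluded 24 a b ex = true)
    (hW3 : ∀ pp : ℕ, 4 ≤ pp → pp ≤ 16 → w3ExcludedPP pp a b ex = true)
    (hSU2 : su2Excluded 40 a b ex = true) (hZK : zkExcluded 40 a b ex = true)
    (D : SigmaEpsilonData) (hD : D.SatisfiesBootstrapAxioms) (hW : (D.Δσ, D.Δε) ∈ W) (v : ℚ)
    (hv : v ∈ kacxFamily) (hvex : v ∉ ex) : D.Δε ≠ (v : ℝ) :=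
  ne_kacx_of_checks hN1 hW3 hSU2 hZK (hR _ (h D hD hW)) v hv hvex

end Summit.CriticalPhenomena.Ising3D
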